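import Literature.Analysis.FluidPDE.TorusStrainSelfAmplificationModel
import Literature.Analysis.FluidPDE.MillerMiddleEigenvalueTorus
import HarnessLib

/-!
# The strain self-amplification model respects the middle-eigenvalue criterion
# (Miller, Anal. PDE 16 (2023), Thm 4.8 at `q = ∞`) — and the determinant forms on `T³`

Analysis/FluidPDE support file (theorems only, fully proved; no definitions, no named facts).
Search for candidate a priori estimates; no regularity claim.

Sequel of `TorusStrainSelfAmplificationModel.lean` (Miller's model `∂ₜS − νΔS + ⅔P_{st}(S²) = 0`
in velocity form, `Torus.IsStrainModelSolutionOn`; Prop 4.3, Prop 5.1, Thm 5.3 = Thm 1.11 typed there)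
for index types of cardinality `3`, where `tr S³ = 3 det S` (tree `det_strain_eq_third_sum_strain_cube`):

* `StrainModelCriteria.four_thirds_integral_trace_strain_cube_eq` — `(4/3)∫tr S³ = 4∫det S`;
* `Torus.IsStrainModelSolutionOn.hasDerivWithinAt_strainNormSq_det` — **Prop 4.3 as printed**:
  `d/dt‖S‖²_{L²} = −ν‖Δu‖² − 4∫det S` (`= −2ν‖S‖²_{Ḣ¹} − 4∫det S`);
* `Torus.IsStrainModelSolutionOn.strainNormSq_rate_le_middleEigenvalue_sup` — the printed chain of
  the proof of Thm 4.8, `∂ₜ‖S‖² = −2‖S‖²_{Ḣ¹} + 4∫(−λ₁λ₃)λ₂ ≤ −2‖S‖²_{Ḣ¹} + 2∫λ₂⁺|S|²`, read with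
  Hölder `(1, ∞)`: every one-sided derivative `R` of `s ↦ ‖S(s)‖²_{L²}` satisfies
  `R ≤ −ν‖Δu(t)‖² + 2Λ‖S(t)‖²_{L²}` whenever `λ₂(S(t,x)) ≤ Λ` for all `x`, `0 ≤ Λ`
  (pointwise Lemma 5.1 of Miller 2020, tree `Miller2019.neg_det_le_half_normSq_mul_posPart_middleEigenvalue`);
* **`Torus.IsStrainModelSolutionOn.strainNormSq_le_mul_exp_integral_middleEigenvalueBound`** —
  **Thm 4.8 at the endpoint `q = ∞`, `p = 1`** (`C_∞ = 2`), periodic classical Grönwall form: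
  `‖S(t)‖²_{L²} ≤ ‖S(a)‖²_{L²} exp(2∫ₐᵗ Λ)` for any continuous nonnegative majorant `Λ(s)` of the
  middle eigenvalue on `[a, b]` (`ν ≥ 0`) — word for word the tree's Navier–Stokes statement
  `torusEnstrophy_le_mul_exp_integral_middleEigenvalueBound` (`MillerMiddleEigenvalueTorus`), which is
  the point of Miller's Remark 1.12: the model "has the same identity for enstrophy growth" and
  "consequently has a regularity criterion for `λ₂⁺` … entirely analogous", yet blows up (Thm 1.11) —
  so the `λ₂⁺` criterion "is not enough … just by making use of the constraint space";
  `….torusEnstrophy_le_mul_exp_integral_middleEigenvalueBound` — the same with `ℰ(u) = ‖S‖²_{L²}`;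
* `Torus.IsStrainModelSolutionOn.time_lt_det` — **Thm 1.11 with the printed functional**
  `f₀ = −3ν‖S⁰‖²_{Ḣ¹} − 4∫det S⁰ > 0 ⟹ T < 2‖S⁰‖²_{L²}/f₀` for classical model solutions on `[0, T]`.

Scope: only the `q = ∞` endpoint of Thm 4.8 is typed (the cases `3/2 < q < ∞` need the Sobolev
step of Miller 2020, Thm 1.1, which the tree has for Navier–Stokes only in the form
`MillerMiddleEigenvalueCriterion`); mild solutions / `T_max` (Thm 4.1) are not formalised — the
statements are a priori inequalities along classical model solutions, as in the parent file.
Search for candidate a priori estimates; no regularity claim.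

## Mathlib / tree search

Tree: `Torus.IsStrainModelSolutionOn.hasDerivWithinAt_strainNormSq/.time_lt/.smooth/.divFree`
(`TorusStrainSelfAmplificationModel`); `det_strain_eq_third_sum_strain_cube`,
`Miller2019.neg_det_le_half_normSq_mul_posPart_middleEigenvalue`,
`IsClassicalNSSolutionOn.enstrophyRate_le_middleEigenvalue_sup`,
`torusEnstrophy_le_mul_exp_integral_middleEigenvalueBound` (`MillerMiddleEigenvalueTorus`, the
Navier–Stokes twins whose proofs are followed line by line); `le_mul_exp_integral_of_hasDerivWithinAt_le_mul`
(`ExtremeGrowthVorticityControl`); `integral_strainNormSq_eq_torusEnstrophy` (`TorusStrainVorticityIsometry`).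

## References

* E. Miller, *Finite-time blowup for a Navier–Stokes model equation for the self-amplification of
  strain*, Anal. PDE 16 (2023) 997–1032 = arXiv:1910.05415: Prop 1.9, Thm 1.11, Rem 1.12 (held text
  chunks 5–6), Prop 4.3 (chunk 13), Thm 4.8 with proof (chunk 15), Thm 5.3 (chunk 17). [Miller2023StrainModel]
* E. Miller, Arch. Ration. Mech. Anal. 235 (2020) 99–139 = arXiv:1710.05569: Thm 1.1 (`q = ∞`),
  Lemma 5.1, Prop 3.1, §4 (`tr S³ = 3 det S`). [Miller2019]
-/

noncomputable section

open MeasureTheory Set Function Finset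
open scoped ContDiff InnerProductSpace RealInnerProductSpace

namespace Literature.Analysis.FluidPDE

open Literature.Analysis.FunctionSpaces

variable {d : Type*} [Fintype d] [DecidableEq d]

namespace StrainModelCriteria

variable {T ν a b : ℝ} {u : ℝ → UnitAddTorus d → EuclideanSpace ℝ d}

/-- `(4/3)∫ tr S³ = 4∫ det S` for the strain of a smooth divergence-free field on `T^d`, `card d = 3`
(`tr S³ = 3 det S` pointwise for trace-free symmetric `S`; tree `det_strain_eq_third_sum_strain_cube`).
[cite: Miller2023StrainModel, Prop 1.9 (`−(4/3)∫tr(S³) = −4∫det S`)] -/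
theorem four_thirds_integral_trace_strain_cube_eq (hd : Fintype.card d = 3)
    {v : UnitAddTorus d → EuclideanSpace ℝ d} (hv : Torus.IsSmooth v) (hdiv : Torus.IsDivFree v) :
    (4 / 3 : ℝ) * ∫ x, ∑ i, ∑ j, ∑ k,
        ((Torus.partialDeriv j v x i + Torus.partialDeriv i v x j) / 2) *
        ((Torus.partialDeriv k v x j + Torus.partialDeriv j v x k) / 2) *
        ((Torus.partialDeriv i v x k + Torus.partialDeriv k v x i) / 2) =
      4 * ∫ x, Matrix.det (Matrix.of fun i j =>
        (Torus.partialDeriv j v x i + Torus.partialDeriv i v x j) / 2) := by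
  simp_rw [det_strain_eq_third_sum_strain_cube hd hv hdiv]
  rw [integral_const_mul]
  ring

/-- **Prop 4.3 in determinant form on `T³`** (Miller, Anal. PDE 16 (2023), Prop 4.3 as printed:
`∂ₜ‖S‖²_{L²} = −2‖S‖²_{Ḣ¹} − 4∫det S` along the strain self-amplification model; `‖S‖²_{Ḣ¹} = ½‖Δu‖²`):
for a classical model solution on `T^d × [a, b]`, `card d = 3`,
`d/dt ∫∑_{ij}S_{ij}² = −ν‖Δu‖² − 4∫det S`. [cite: Miller2023StrainModel, Prop 4.3] -/
theorem _root_.Literature.Analysis.FluidPDE.Torus.IsStrainModelSolutionOn.hasDerivWithinAt_strainNormSq_det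
    [Nonempty d] (hd : Fintype.card d = 3) (h : Torus.IsStrainModelSolutionOn (Icc a b) ν u)
    (hab : a < b) {t : ℝ} (ht : t ∈ Icc a b) :
    HasDerivWithinAt
      (fun s => ∫ x, ∑ i, ∑ j, ((Torus.partialDeriv j (u s) x i + Torus.partialDeriv i (u s) x j) / 2) ^ 2)
      (-(ν * ∫ x, ‖Torus.laplacian (u t) x‖ ^ 2) -
        4 * ∫ x, Matrix.det (Matrix.of fun i j =>
          (Torus.partialDeriv j (u t) x i + Torus.partialDeriv i (u t) x j) / 2))
      (Icc a b) t := by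
  rw [← four_thirds_integral_trace_strain_cube_eq hd (h.smooth.isSmooth_slice ht) (h.divFree ht)]
  exact h.hasDerivWithinAt_strainNormSq hab ht

/-- **`dE/dt ≤ −ν‖Δu‖² + 2‖λ₂⁺‖_∞ E` along the model** (`E = ‖S‖²_{L²}`): the printed chain of the
proof of Thm 4.8, `∂ₜ‖S‖² = −2‖S‖²_{Ḣ¹} − 4∫det S = −2‖S‖²_{Ḣ¹} + 4∫(−λ₁λ₃)λ₂ ≤ −2‖S‖²_{Ḣ¹} + 2∫λ₂⁺|S|²`,
read with Hölder `(1, ∞)` (the `q = ∞` endpoint, no Sobolev step): on `T^d × [a, b]`, `card d = 3`,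
if the middle eigenvalue of `S(t, x)` is `≤ Λ` for all `x` (`0 ≤ Λ`), every one-sided derivative `R`
of `s ↦ ∫∑S(s)²` within `[a, b]` at `t` satisfies `R ≤ −ν‖Δu(t)‖² + 2Λ ∫∑S(t)²` (pointwise
Lemma 5.1 of Miller 2020, tree `Miller2019.neg_det_le_half_normSq_mul_posPart_middleEigenvalue`).
[cite: Miller2023StrainModel, Thm 4.8 (proof); Miller2019, Lemma 5.1] -/
theorem _root_.Literature.Analysis.FluidPDE.Torus.IsStrainModelSolutionOn.strainNormSq_rate_le_middleEigenvalue_sup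
    [Nonempty d] (hd : Fintype.card d = 3) (h : Torus.IsStrainModelSolutionOn (Icc a b) ν u)
    (hab : a < b) {t : ℝ} (ht : t ∈ Icc a b) {Λ : ℝ} (hΛ0 : 0 ≤ Λ)
    (hΛ : ∀ x, ∀ hx : (Matrix.of fun i j =>
        (Torus.partialDeriv j (u t) x i + Torus.partialDeriv i (u t) x j) / 2).IsHermitian,
        hx.eigenvalues₀ (Fin.cast hd.symm 1) ≤ Λ)
    (R : ℝ) (hR : HasDerivWithinAt
      (fun s => ∫ x, ∑ i, ∑ j, ((Torus.partialDeriv j (u s) x i + Torus.partialDeriv i (u s) x j) / 2) ^ 2)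
      R (Icc a b) t) :
    R ≤ -ν * (∫ x, ‖Torus.laplacian (u t) x‖ ^ 2) +
      2 * Λ * ∫ x, ∑ i, ∑ j, ((Torus.partialDeriv j (u t) x i + Torus.partialDeriv i (u t) x j) / 2) ^ 2 := by
  have hut : Torus.IsSmooth (u t) := h.smooth.isSmooth_slice ht
  have hdivt : Torus.IsDivFree (u t) := h.divFree ht
  have hU : UniqueDiffWithinAt ℝ (Icc a b) t := uniqueDiffOn_Icc hab t ht
  have hbal := h.hasDerivWithinAt_strainNormSq_det hd hab ht
  have hReq : R = -(ν * ∫ x, ‖Torus.laplacian (u t) x‖ ^ 2) -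
      4 * ∫ x, Matrix.det (Matrix.of fun i j =>
        (Torus.partialDeriv j (u t) x i + Torus.partialDeriv i (u t) x j) / 2) :=
    (hR.derivWithin hU).symm.trans (hbal.derivWithin hU)
  set Sd : UnitAddTorus d → Matrix d d ℝ := fun x => Matrix.of fun i j =>
    (Torus.partialDeriv j (u t) x i + Torus.partialDeriv i (u t) x j) / 2 with hSd
  set F : UnitAddTorus d → ℝ := fun x => ∑ i, ∑ j,
    ((Torus.partialDeriv j (u t) x i + Torus.partialDeriv i (u t) x j) / 2) ^ 2 with hF
  have hpt : ∀ x, -4 * (Sd x).det ≤ 2 * Λ * F x := by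
    intro x
    have hsym : (Sd x).IsSymm := by
      refine Matrix.IsSymm.ext fun i j => ?_
      simp only [hSd, Matrix.of_apply]; ring
    have htr : (Sd x).trace = 0 := by
      simp only [Matrix.trace, Matrix.diag, hSd, Matrix.of_apply]
      have h1 : ∑ i, (Torus.partialDeriv i (u t) x i + Torus.partialDeriv i (u t) x i) / 2 =
          ∑ i, Torus.partialDeriv i (u t) x i := Finset.sum_congr rfl fun i _ => by ring
      rw [h1, ← Torus.divergence_eq_sum_partialDeriv_apply (hut.isContDiff (by simp)) x]
      exact hdivt x
    have h51 := Miller2019.neg_det_le_half_normSq_mul_posPart_middleEigenvalue hd (Sd x) hsym htr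
    have hmax : max ((Matrix.isHermitian_iff_isSymm.mpr hsym).eigenvalues₀ (Fin.cast hd.symm 1)) 0
        ≤ Λ := max_le (hΛ x _) hΛ0
    have hFx : ∑ i, ∑ j, Sd x i j ^ 2 = F x := by simp only [hSd, hF, Matrix.of_apply]
    rw [hFx] at h51
    have hF0 : 0 ≤ F x := Finset.sum_nonneg fun i _ => Finset.sum_nonneg fun j _ => sq_nonneg _
    have h2 : 2⁻¹ * F x * max ((Matrix.isHermitian_iff_isSymm.mpr hsym).eigenvalues₀
        (Fin.cast hd.symm 1)) 0 ≤ 2⁻¹ * F x * Λ :=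
      mul_le_mul_of_nonneg_left hmax (by positivity)
    linarith
  have hD : ∀ m, Torus.IsSmooth (Torus.partialDeriv m (u t)) := fun m => hut.partialDeriv m
  have hDc : ∀ m j, Torus.IsSmooth (fun y => Torus.partialDeriv m (u t) y j) :=
    fun m j => (hD m).apply j
  have hSc : ∀ i j, Torus.IsSmooth (fun x => (Torus.partialDeriv j (u t) x i +
      Torus.partialDeriv i (u t) x j) / 2) := fun i j => ((hDc j i).add (hDc i j)).div_const 2
  have hFs : Torus.IsSmooth F := by
    have hh : ∀ i j, Torus.IsSmooth (fun x =>
        ((Torus.partialDeriv j (u t) x i + Torus.partialDeriv i (u t) x j) / 2) ^ 2) :=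
      fun i j => (hSc i j).pow 2
    unfold Torus.IsSmooth at hh ⊢
    exact ContDiff.sum fun i _ => ContDiff.sum fun j _ => hh i j
  have hdetI : Integrable (fun x => (Sd x).det) volume := by
    have hTs : Torus.IsSmooth (fun x => ∑ i, ∑ j, ∑ k,
        ((Torus.partialDeriv j (u t) x i + Torus.partialDeriv i (u t) x j) / 2) *
        ((Torus.partialDeriv k (u t) x j + Torus.partialDeriv j (u t) x k) / 2) *
        ((Torus.partialDeriv i (u t) x k + Torus.partialDeriv k (u t) x i) / 2)) := by
      have hh : ∀ i j k, Torus.IsSmooth (fun x =>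
          ((Torus.partialDeriv j (u t) x i + Torus.partialDeriv i (u t) x j) / 2) *
          ((Torus.partialDeriv k (u t) x j + Torus.partialDeriv j (u t) x k) / 2) *
          ((Torus.partialDeriv i (u t) x k + Torus.partialDeriv k (u t) x i) / 2)) :=
        fun i j k => ((hSc i j).mul (hSc j k)).mul (hSc k i)
      unfold Torus.IsSmooth at hh ⊢
      exact ContDiff.sum fun i _ => ContDiff.sum fun j _ => ContDiff.sum fun k _ => hh i j k
    exact (hTs.integrable.const_mul (1 / 3 : ℝ)).congr
      (Filter.Eventually.of_forall fun x => (det_strain_eq_third_sum_strain_cube hd hut hdivt x).symm)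
  have hmono : ∫ x, -4 * (Sd x).det ≤ ∫ x, 2 * Λ * F x :=
    integral_mono (hdetI.const_mul _) (hFs.integrable.const_mul _) hpt
  rw [integral_const_mul, integral_const_mul] at hmono
  have hSd' : (∫ x, Matrix.det (Matrix.of fun i j =>
      (Torus.partialDeriv j (u t) x i + Torus.partialDeriv i (u t) x j) / 2)) = ∫ x, (Sd x).det := rfl
  have hF' : (∫ x, ∑ i, ∑ j, ((Torus.partialDeriv j (u t) x i + Torus.partialDeriv i (u t) x j) / 2) ^ 2) =
      ∫ x, F x := rfl
  rw [hReq, hSd', hF']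
  linarith

/-- **Miller, Anal. PDE 16 (2023), Thm 4.8 at the endpoint `q = ∞` (`p = 1`) — the strain
self-amplification model respects the middle-eigenvalue regularity criterion, Grönwall form**
(printed: `‖S(t)‖²_{L²} ≤ ‖S⁰‖²_{L²} exp(C_q ∫₀ᵗ ‖λ₂⁺‖^p_{L^q})`, `3/q + 2/p = 2`; here `q = ∞`,
`C_∞ = 2`, periodic classical version, exactly parallel to the tree's Navier–Stokes statement
`torusEnstrophy_le_mul_exp_integral_middleEigenvalueBound`): along a classical model solution on
`T^d × [a, b]`, `card d = 3`, `ν ≥ 0`, if `Λ` is continuous and nonnegative on `[a, b]` and bounds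
the middle eigenvalue of `S(s, x)` for all `s ∈ [a, b]` and `x`, then
`∫∑S(t)² ≤ (∫∑S(a)²) · exp(2∫ₐᵗ Λ)` for every `t ∈ [a, b]` — "there must be unbounded planar
stretching … in order for there to be blowup" for the model as for Navier–Stokes (Remark 1.12: this
criterion "is not enough … just by making use of the constraint space").
[cite: Miller2023StrainModel, Thm 4.8 and Rem 1.12; Miller2019, Thm 1.1 (q = ∞) and Lemma 5.1] -/
theorem _root_.Literature.Analysis.FluidPDE.Torus.IsStrainModelSolutionOn.strainNormSq_le_mul_exp_integral_middleEigenvalueBound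
    [Nonempty d] (hd : Fintype.card d = 3) (hν : 0 ≤ ν) (hab : a < b)
    (h : Torus.IsStrainModelSolutionOn (Icc a b) ν u)
    {Λ : ℝ → ℝ} (hΛc : ContinuousOn Λ (Icc a b)) (hΛ0 : ∀ s ∈ Icc a b, 0 ≤ Λ s)
    (hΛ : ∀ s ∈ Icc a b, ∀ x, ∀ hx : (Matrix.of fun i j =>
        (Torus.partialDeriv j (u s) x i + Torus.partialDeriv i (u s) x j) / 2).IsHermitian,
        hx.eigenvalues₀ (Fin.cast hd.symm 1) ≤ Λ s)
    {t : ℝ} (ht : t ∈ Icc a b) :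
    (∫ x, ∑ i, ∑ j, ((Torus.partialDeriv j (u t) x i + Torus.partialDeriv i (u t) x j) / 2) ^ 2) ≤
      (∫ x, ∑ i, ∑ j, ((Torus.partialDeriv j (u a) x i + Torus.partialDeriv i (u a) x j) / 2) ^ 2) *
        Real.exp (2 * ∫ s in a..t, Λ s) := by
  set G : ℝ → ℝ := fun s => -(ν * ∫ x, ‖Torus.laplacian (u s) x‖ ^ 2) -
      4 * ∫ x, Matrix.det (Matrix.of fun i j =>
        (Torus.partialDeriv j (u s) x i + Torus.partialDeriv i (u s) x j) / 2) with hG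
  have hder : ∀ s ∈ Icc a b, HasDerivWithinAt
      (fun r => ∫ x, ∑ i, ∑ j, ((Torus.partialDeriv j (u r) x i + Torus.partialDeriv i (u r) x j) / 2) ^ 2)
      (G s) (Icc a b) s :=
    fun s hs => h.hasDerivWithinAt_strainNormSq_det hd hab hs
  have hle : ∀ s ∈ Icc a b, G s ≤ (2 * Λ s) *
      ∫ x, ∑ i, ∑ j, ((Torus.partialDeriv j (u s) x i + Torus.partialDeriv i (u s) x j) / 2) ^ 2 := by
    intro s hs
    have h1 := h.strainNormSq_rate_le_middleEigenvalue_sup hd hab hs (hΛ0 s hs) (hΛ s hs) (G s) (hder s hs)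
    have hdiss : 0 ≤ ν * ∫ x, ‖Torus.laplacian (u s) x‖ ^ 2 :=
      mul_nonneg hν (integral_nonneg fun x => sq_nonneg _)
    linarith
  have hk : ContinuousOn (fun s => 2 * Λ s) (Icc a b) := continuousOn_const.mul hΛc
  have hmain := le_mul_exp_integral_of_hasDerivWithinAt_le_mul hab hder hk hle ht
  rwa [intervalIntegral.integral_const_mul] at hmain

/-- The same in the cell's enstrophy variable: `ℰ(u(t)) ≤ ℰ(u(a)) exp(2∫ₐᵗ Λ)` along the model
(`‖S‖²_{L²} = ℰ(u)`, tree `integral_strainNormSq_eq_torusEnstrophy`).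
[cite: Miller2023StrainModel, Thm 4.8; Miller2019, Prop 3.1] -/
theorem _root_.Literature.Analysis.FluidPDE.Torus.IsStrainModelSolutionOn.torusEnstrophy_le_mul_exp_integral_middleEigenvalueBound
    [Nonempty d] (hd : Fintype.card d = 3) (hν : 0 ≤ ν) (hab : a < b)
    (h : Torus.IsStrainModelSolutionOn (Icc a b) ν u)
    {Λ : ℝ → ℝ} (hΛc : ContinuousOn Λ (Icc a b)) (hΛ0 : ∀ s ∈ Icc a b, 0 ≤ Λ s)
    (hΛ : ∀ s ∈ Icc a b, ∀ x, ∀ hx : (Matrix.of fun i j =>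
        (Torus.partialDeriv j (u s) x i + Torus.partialDeriv i (u s) x j) / 2).IsHermitian,
        hx.eigenvalues₀ (Fin.cast hd.symm 1) ≤ Λ s)
    {t : ℝ} (ht : t ∈ Icc a b) :
    torusEnstrophy (u t) ≤ torusEnstrophy (u a) * Real.exp (2 * ∫ s in a..t, Λ s) := by
  rw [← integral_strainNormSq_eq_torusEnstrophy (h.smooth.isSmooth_slice ht) (h.divFree ht),
    ← integral_strainNormSq_eq_torusEnstrophy (h.smooth.isSmooth_slice (Set.left_mem_Icc.2 hab.le))
      (h.divFree (Set.left_mem_Icc.2 hab.le))]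
  exact h.strainNormSq_le_mul_exp_integral_middleEigenvalueBound hd hν hab hΛc hΛ0 hΛ ht

/-- **Thm 1.11 with the printed determinant**: on `T³` the blow-up functional of Miller's Thm 1.11 /
Thm 5.3 reads `f₀ = −3ν‖S⁰‖²_{Ḣ¹} − 4∫det S⁰` (`= −3ν·½‖Δu₀‖² − (4/3)∫tr(S⁰)³`), and a classical
model solution on `[0, T]` with `f₀ > 0` has `T < 2‖S⁰‖²_{L²}/f₀`.
[cite: Miller2023StrainModel, Thm 1.11 and Thm 5.3] -/
theorem _root_.Literature.Analysis.FluidPDE.Torus.IsStrainModelSolutionOn.time_lt_det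
    [Nonempty d] (hd : Fintype.card d = 3) (h : Torus.IsStrainModelSolutionOn (Icc 0 T) ν u)
    (hT : 0 < T) (hν : 0 ≤ ν)
    (hf₀ : 0 < -(3 * ν) * (2⁻¹ * ∫ x, ‖Torus.laplacian (u 0) x‖ ^ 2) -
      4 * ∫ x, Matrix.det (Matrix.of fun i j =>
        (Torus.partialDeriv j (u 0) x i + Torus.partialDeriv i (u 0) x j) / 2)) :
    T < 2 * (∫ x, ∑ i, ∑ j, ((Torus.partialDeriv j (u 0) x i + Torus.partialDeriv i (u 0) x j) / 2) ^ 2) /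
      (-(3 * ν) * (2⁻¹ * ∫ x, ‖Torus.laplacian (u 0) x‖ ^ 2) -
        4 * ∫ x, Matrix.det (Matrix.of fun i j =>
          (Torus.partialDeriv j (u 0) x i + Torus.partialDeriv i (u 0) x j) / 2)) := by
  have h0 : (0 : ℝ) ∈ Icc 0 T := Set.left_mem_Icc.2 hT.le
  rw [← four_thirds_integral_trace_strain_cube_eq hd (h.smooth.isSmooth_slice h0) (h.divFree h0)]
    at hf₀ ⊢
  exact h.time_lt hT hν hf₀

end StrainModelCriteria

end Literature.Analysis.FluidPDE
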